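import Summits.BirchSwinnertonDyer.Rank1Residual.GaloisImage.KolyvaginSystemsCoreRankZero
import HarnessLib

/-!
# Route `KimAtThreeKolyvagin` (rung W2), crux `DeepUpperAtThree`: COUNTING lemmas for the STUB port
# at a general modulus — torsion filtrations, multiples, and the strict step at one Kolyvagin prime

Cell `bsd-addord`, seat `bsd-addord-w2-c3` (D-0074 row B6), item `stmt-BirchSwinnertonDyer-19076`.
TOOL theorems (finite abelian groups; Selmer structures of a finite discrete `Γ_K`-module at one
Kolyvagin prime); no definition, no named fact, no `sorry`; nothing asserted about any curve.
Consumed by the sibling `KimAtThreeDeepUpperStubLiftable.lean` (Mazur–Rubin Thm. 4.4.3).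

WHY.  On the Kato stratum crux 19076 is reduced (`KimAtThreeDeepUpperOfPortsDevissage`) to PUB
facts, one port, and ONE inline hypothesis `hStub` = the STUB at `∅` for the generator of
`KS(E[3^{k+1}], 𝓕_can)` (Mazur–Rubin Thm. 4.4.1, general modulus).  Mazur–Rubin's Thm. 4.4.3
("sufficiently liftable" Kolyvagin systems are stub sections, Mem. AMS 799 pp. 46–47) proves the
same conclusion WITHOUT Howard's appendix and without the connectedness of `𝒳⁰`, by an induction
whose ingredients are COUNTS: Lemma 4.1.1 (torsion), Thm. 4.1.13 (structure = counts of
`H[p^i]`), Lemma 4.1.6/4.1.7 (one prime), Lemma 4.2.1.  This file supplies those counts in the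
tree's currency (`AddSubgroup`s of `H¹(K, T)`, `p^i`-torsion = `⊓ (nsmulAddMonoidHom (p^i)).ker`,
multiples = `map (nsmulAddMonoidHom (p^i))`, `Nat.card`):
* §0 first-isomorphism counting, `p`-power orders, Lagrange, `p`-torsion of non-zero elements;
* §1 the strict step at a Kolyvagin prime `𝔮 ∉ d` with `H¹_ur ⊓ H¹_tr = 0`:
  `H¹_{𝓕(d𝔮)} ∩ ker loc^s_𝔮 = H¹_{𝓕(d)} ∩ ker loc_𝔮` and its counted form on `p^k`-torsion
  (Mazur–Rubin Lemma 4.1.6 (ii), "`a + c = b + d`");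
* §2 Case 1 of the proof of Thm. 4.4.3, counted: in `G` killed by `p^{a+j+r}` with
  `#p^a G = p^{j+r}`, `#p^{a+r} G = p^j`, `#p^{a+j} G = p^r`, an element of `p^a G` killed by `p^r` lies
  in `p^{a+j} G`; the counts of multiples from the counts of torsion; stability of the torsion
  filtration `Y[p^i] = Y[p^k]` (`i ≥ j`) when `#Y[p^k] = p^j < p^k`.
[cite: MazurRubin2004, Lemma 4.1.1, Lemma 4.1.6, Thm. 4.1.13, Thm. 4.4.3 (pp. 35–47)]
[cite: Rubin2011, Prop. 2.6.1 (p. 22)]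
-/

set_option autoImplicit false
-- the Theorems namespace of a single-conjunct summit repeats the summit name by design (D-0017)
set_option linter.dupNamespace false

noncomputable section

open scoped Classical NumberField ContRepresentation
open Function NumberField IsDedekindDomain
  Literature.NumberTheory.GaloisRepresentations
  Literature.NumberTheory.GaloisRepresentations.DiscreteGaloisModule Literature.NumberTheory.GaloisCohomology
  Summit.BirchSwinnertonDyer.Rank1Residual.GaloisImage
  Summit.BirchSwinnertonDyer.Rank1Residual.GaloisImage.CoreRankZero

universe u

namespace Summit.BirchSwinnertonDyer.BirchSwinnertonDyer.Theorems.KimAtThreeDeepUpperStubCounting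

namespace StubLift

/-! ### §0 Counting in finite abelian groups -/

section Counting

variable {A B : Type*} [AddCommGroup A] [AddCommGroup B]

/-- First isomorphism theorem, counted: `#G = #(G ⊓ ker f) · #f(G)` for a finite subgroup `G`.
[folklore] -/
theorem card_eq_card_inf_ker_mul_card_map (f : A →+ B) (G : AddSubgroup A) [Finite G] :
    Nat.card G = Nat.card ↥(G ⊓ f.ker) * Nat.card ↥(G.map f) := by
  let g : G →+ B := f.comp G.subtype
  have h1 := AddSubgroup.card_eq_card_quotient_mul_card_addSubgroup g.ker
  rw [Nat.card_congr (QuotientAddGroup.quotientKerEquivRange g).toEquiv] at h1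
  have hrange : g.range = G.map f := by
    rw [AddMonoidHom.range_comp, AddSubgroup.range_subtype]
  have hker : Nat.card g.ker = Nat.card ↥(G ⊓ f.ker) := by
    have : g.ker = (G ⊓ f.ker).addSubgroupOf G := by
      ext x
      simp only [AddMonoidHom.mem_ker, AddSubgroup.mem_addSubgroupOf, AddSubgroup.mem_inf,
        SetLike.coe_mem, true_and, g, AddMonoidHom.coe_comp, AddSubgroup.coe_subtype,
        Function.comp_apply]
    rw [this]
    exact Nat.card_congr (AddSubgroup.addSubgroupOfEquivOfLe inf_le_left).toEquiv
  rw [h1, hrange, hker, mul_comm]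

/-- A finite subgroup killed by a power of the prime `p` has `p`-power order. [folklore] -/
theorem exists_card_eq_prime_pow {p : ℕ} [hp : Fact p.Prime] (G : AddSubgroup A) [Finite G]
    {m : ℕ} (hG : ∀ x ∈ G, p ^ m • x = 0) : ∃ a : ℕ, Nat.card G = p ^ a := by
  have hP : IsPGroup p (Multiplicative G) := fun g => ⟨m, by
    change Multiplicative.ofAdd (p ^ m • (Multiplicative.toAdd g)) = 1
    have : p ^ m • (Multiplicative.toAdd g : G) = 0 := Subtype.ext (hG _ (Multiplicative.toAdd g).2)
    rw [this]; rfl⟩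
  obtain ⟨a, ha⟩ := IsPGroup.iff_card.mp hP
  exact ⟨a, ha⟩

/-- Lagrange in additive form inside a subgroup: `#G • x = 0` for `x ∈ G`. [folklore] -/
theorem card_nsmul_eq_zero_of_mem (G : AddSubgroup A) {x : A} (hx : x ∈ G) :
    Nat.card G • x = 0 := by
  have h := card_nsmul_eq_zero' (G := G) (x := ⟨x, hx⟩)
  exact congrArg Subtype.val h

/-- If `#G ≤ N` with `G` killed by `p^m` and `N` a power of `p`, then `N • x = 0` on `G`.
[folklore] -/
theorem nsmul_eq_zero_of_card_le_pow {p : ℕ} [hp : Fact p.Prime] (G : AddSubgroup A) [Finite G]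
    {m : ℕ} (hG : ∀ x ∈ G, p ^ m • x = 0) {ℓ : ℕ} (hle : Nat.card G ≤ p ^ ℓ) {x : A} (hx : x ∈ G) :
    p ^ ℓ • x = 0 := by
  obtain ⟨a, ha⟩ := exists_card_eq_prime_pow G hG
  rw [ha] at hle
  have hal : a ≤ ℓ := (Nat.pow_le_pow_iff_right hp.out.one_lt).mp hle
  have h := card_nsmul_eq_zero_of_mem G hx
  rw [ha] at h
  obtain ⟨c, rfl⟩ := Nat.exists_eq_add_of_le hal
  rw [pow_add, mul_nsmul, h, nsmul_zero]

/-- In a group killed by `p^m`, a non-zero element has a non-zero multiple killed by `p`.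
[folklore] -/
theorem exists_nsmul_ne_zero_and_prime_nsmul_eq_zero {p : ℕ} {m : ℕ} {x : A}
    (hx : p ^ m • x = 0) (hx0 : x ≠ 0) : ∃ s : ℕ, p ^ s • x ≠ 0 ∧ p • (p ^ s • x) = 0 := by
  classical
  have hex : ∃ a : ℕ, p ^ a • x = 0 := ⟨m, hx⟩
  let a := Nat.find hex
  have ha : p ^ a • x = 0 := Nat.find_spec hex
  have ha0 : a ≠ 0 := by
    intro h
    rw [h, pow_zero, one_nsmul] at ha
    exact hx0 ha
  refine ⟨a - 1, ?_, ?_⟩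
  · have := Nat.find_min hex (m := a - 1) (by omega)
    exact this
  · rw [← mul_nsmul, ← pow_succ, Nat.sub_add_cancel (Nat.one_le_iff_ne_zero.mpr ha0)]
    exact ha

/-- A subgroup killed by `p^m` with trivial `p`-torsion is trivial. [folklore] -/
theorem eq_bot_of_prime_torsion_eq_bot {p : ℕ} (G : AddSubgroup A) {m : ℕ}
    (hG : ∀ x ∈ G, p ^ m • x = 0) (h : ∀ x ∈ G, p • x = 0 → x = 0) : G = ⊥ := by
  rw [eq_bot_iff]
  intro x hx
  by_contra hx0
  obtain ⟨s, hs, hps⟩ := exists_nsmul_ne_zero_and_prime_nsmul_eq_zero (hG x hx) hx0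
  exact hs (h _ (G.nsmul_mem hx _) hps)

end Counting

/-! ### §1 The setting; the strict step `𝓕(d) ∩ ker loc_𝔮 = 𝓕(d𝔮) ∩ ker loc^s_𝔮` -/

variable {K : Type u} [Field K] [NumberField K]
variable {M : Type u} [AddCommGroup M] [TopologicalSpace M] [DiscreteTopology M]
variable {ρ : DiscreteGaloisModule K M}

/-- Finiteness of `G ⊓ G'` from finiteness of `G`. [folklore] -/
theorem finite_inf_left {V : Type*} [AddCommGroup V] (G G' : AddSubgroup V) [Finite G] :
    Finite ↥(G ⊓ G') :=
  Finite.of_injective _ (AddSubgroup.inclusion_injective inf_le_left)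

/-- Finiteness of the image `f(G)` of a finite subgroup. [folklore] -/
theorem finite_map {V W : Type*} [AddCommGroup V] [AddCommGroup W] (f : V →+ W)
    (G : AddSubgroup V) [Finite G] : Finite ↥(G.map f) := by
  refine Finite.of_surjective (fun x : G => (⟨f x, AddSubgroup.mem_map_of_mem f x.2⟩ : G.map f)) ?_
  rintro ⟨y, hy⟩
  obtain ⟨x, hx, rfl⟩ := AddSubgroup.mem_map.mp hy
  exact ⟨⟨x, hx⟩, rfl⟩

/-- **The strict step (Mazur–Rubin Lemma 4.1.6, the common corner `H¹_{𝓕_𝔮(n)}`).**  For a level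
`d`, a Kolyvagin prime `𝔮 ∉ d` off `S` with `H¹_ur(K_𝔮, M) ⊓ H¹_tr(K_𝔮, M) = 0`: a class lies in
`H¹_{𝓕(d𝔮)}` with ZERO SINGULAR PART at `𝔮` iff it lies in `H¹_{𝓕(d)}` with ZERO LOCALISATION at
`𝔮` (both say: the `𝓕`-conditions off `𝔮`, and `loc_𝔮 = 0`).
[cite: MazurRubin2004, Lemma 4.1.6 (p. 36), the two diagrams] -/
theorem mem_atLevel_insert_and_singular_eq_zero_iff (𝓕 : SelmerStructure ρ) {D : KolyvaginDatum ρ}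
    (hUT : ∀ q ∈ D.primes,
      unramifiedSubgroup (GaloisRep.toLocal q ρ) 1 ⊓ D.transverse (Sum.inr q) = ⊥)
    (d : Finset (HeightOneSpectrum (𝓞 K))) {q : HeightOneSpectrum (𝓞 K)} (hq : q ∈ D.primes)
    (b : galoisCohomology ρ 1) :
    (b ∈ (D.atLevel 𝓕 (insert q d)).selmerGroup ∧ KolyvaginDatum.singularLocalization ρ q b = 0) ↔
      (b ∈ (D.atLevel 𝓕 d).selmerGroup ∧ galoisCohomology.localization ρ (Sum.inr q) 1 b = 0) := by
  have hUT' : (min (unramifiedSubgroup (GaloisRep.toLocal q ρ) 1) (D.transverse (Sum.inr q)) :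
      AddSubgroup (galoisCohomology (ρ.toLocal (Sum.inr q)) 1)) = ⊥ := hUT q hq
  have hL : KolyvaginDatum.singularLocalization ρ q b =
      singularMap (GaloisRep.toLocal q ρ) (galoisCohomology.localization ρ (Sum.inr q) 1 b) := rfl
  constructor
  · rintro ⟨hb, hs⟩
    -- `loc_𝔮 b ∈ H¹_ur ⊓ H¹_tr = 0`
    have hur : galoisCohomology.localization ρ (Sum.inr q) 1 b ∈
        unramifiedSubgroup (GaloisRep.toLocal q ρ) 1 := by
      rw [hL, singularMap_eq_zero_iff] at hs
      exact hs
    have htr := (SelmerStructure.mem_selmerGroup_iff _ _).1 hb (Sum.inr q)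
    rw [Level.atLevel_insert_inr_self] at htr
    have h0 : galoisCohomology.localization ρ (Sum.inr q) 1 b = 0 := by
      have hmem : galoisCohomology.localization ρ (Sum.inr q) 1 b ∈
          (min (unramifiedSubgroup (GaloisRep.toLocal q ρ) 1) (D.transverse (Sum.inr q)) :
            AddSubgroup (galoisCohomology (ρ.toLocal (Sum.inr q)) 1)) :=
        AddSubgroup.mem_inf.2 ⟨hur, htr⟩
      rwa [hUT', AddSubgroup.mem_bot] at hmem
    refine ⟨mem_selmerGroup_of_forall_ne q (fun v hv => le_of_eq ?_) hb ?_, h0⟩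
    · rw [Level.atLevel_insert_apply_of_ne D 𝓕 q hv]
    · rw [h0]; exact zero_mem _
  · rintro ⟨hb, h0⟩
    refine ⟨mem_selmerGroup_of_forall_ne q (fun v hv => le_of_eq ?_) hb ?_, ?_⟩
    · rw [Level.atLevel_insert_apply_of_ne D 𝓕 q hv]
    · rw [h0]; exact zero_mem _
    · have h0' : @Eq (galoisCohomology (GaloisRep.toLocal q ρ) 1)
          (galoisCohomology.localization ρ (Sum.inr q) 1 b) 0 := h0
      rw [hL, h0', map_zero]

/-- Counted form of the strict step: `#H¹_{𝓕(d𝔮)}[p^k] · #loc_𝔮(H¹_{𝓕(d)}[p^k]) =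
#H¹_{𝓕(d)}[p^k] · #loc^s_𝔮(H¹_{𝓕(d𝔮)}[p^k])` — the two groups modulo the common kernel
(Mazur–Rubin Lemma 4.1.6 (ii) "`a + c = b + d`", on `p^k`-torsion). [cite: MazurRubin2004, Lemma 4.1.6 (ii) (p. 37)] -/
theorem card_torsion_mul_card_loc_eq (𝓕 : SelmerStructure ρ) {D : KolyvaginDatum ρ}
    (hUT : ∀ q ∈ D.primes,
      unramifiedSubgroup (GaloisRep.toLocal q ρ) 1 ⊓ D.transverse (Sum.inr q) = ⊥)
    (hfin : ∀ d, Finite (D.atLevel 𝓕 d).selmerGroup)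
    (d : Finset (HeightOneSpectrum (𝓞 K))) {q : HeightOneSpectrum (𝓞 K)} (hq : q ∈ D.primes)
    (N : ℕ) :
    Nat.card ↥((D.atLevel 𝓕 (insert q d)).selmerGroup ⊓ (nsmulAddMonoidHom N).ker) *
        Nat.card ↥(((D.atLevel 𝓕 d).selmerGroup ⊓ (nsmulAddMonoidHom N).ker).map
          (galoisCohomology.localization ρ (Sum.inr q) 1)) =
      Nat.card ↥((D.atLevel 𝓕 d).selmerGroup ⊓ (nsmulAddMonoidHom N).ker) *
        Nat.card ↥(((D.atLevel 𝓕 (insert q d)).selmerGroup ⊓ (nsmulAddMonoidHom N).ker).map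
          (KolyvaginDatum.singularLocalization ρ q)) := by
  haveI := hfin d
  haveI := hfin (insert q d)
  haveI := finite_inf_left (D.atLevel 𝓕 d).selmerGroup
    ((nsmulAddMonoidHom N : galoisCohomology ρ 1 →+ _).ker)
  haveI := finite_inf_left (D.atLevel 𝓕 (insert q d)).selmerGroup
    ((nsmulAddMonoidHom N : galoisCohomology ρ 1 →+ _).ker)
  have h1 := card_eq_card_inf_ker_mul_card_map (galoisCohomology.localization ρ (Sum.inr q) 1)
    ((D.atLevel 𝓕 d).selmerGroup ⊓ (nsmulAddMonoidHom N).ker)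
  have h2 := card_eq_card_inf_ker_mul_card_map (KolyvaginDatum.singularLocalization ρ q)
    ((D.atLevel 𝓕 (insert q d)).selmerGroup ⊓ (nsmulAddMonoidHom N).ker)
  -- the two kernels coincide
  have hker : (D.atLevel 𝓕 (insert q d)).selmerGroup ⊓ (nsmulAddMonoidHom N).ker ⊓
        (KolyvaginDatum.singularLocalization ρ q).ker =
      (D.atLevel 𝓕 d).selmerGroup ⊓ (nsmulAddMonoidHom N).ker ⊓
        (galoisCohomology.localization ρ (Sum.inr q) 1).ker := by
    ext b
    simp only [AddSubgroup.mem_inf, AddMonoidHom.mem_ker]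
    have h := mem_atLevel_insert_and_singular_eq_zero_iff 𝓕 hUT d hq b
    constructor
    · rintro ⟨⟨hb, hN⟩, hs⟩
      exact ⟨⟨(h.1 ⟨hb, hs⟩).1, hN⟩, (h.1 ⟨hb, hs⟩).2⟩
    · rintro ⟨⟨hb, hN⟩, hs⟩
      exact ⟨⟨(h.2 ⟨hb, hs⟩).1, hN⟩, (h.2 ⟨hb, hs⟩).2⟩
  have hB : Nat.card ↥((D.atLevel 𝓕 (insert q d)).selmerGroup ⊓ (nsmulAddMonoidHom N).ker ⊓
        (KolyvaginDatum.singularLocalization ρ q).ker) =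
      Nat.card ↥((D.atLevel 𝓕 d).selmerGroup ⊓ (nsmulAddMonoidHom N).ker ⊓
        (galoisCohomology.localization ρ (Sum.inr q) 1).ker) := by
    rw [hker]
  generalize Nat.card ↥((D.atLevel 𝓕 (insert q d)).selmerGroup ⊓ (nsmulAddMonoidHom N).ker ⊓
        (KolyvaginDatum.singularLocalization ρ q).ker) = z1 at h2 hB
  generalize Nat.card ↥((D.atLevel 𝓕 d).selmerGroup ⊓ (nsmulAddMonoidHom N).ker ⊓
        (galoisCohomology.localization ρ (Sum.inr q) 1).ker) = z2 at h1 hB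
  generalize Nat.card ↥(((D.atLevel 𝓕 d).selmerGroup ⊓ (nsmulAddMonoidHom N).ker).map
          (galoisCohomology.localization ρ (Sum.inr q) 1)) = c at h1 ⊢
  generalize Nat.card ↥(((D.atLevel 𝓕 (insert q d)).selmerGroup ⊓ (nsmulAddMonoidHom N).ker).map
          (KolyvaginDatum.singularLocalization ρ q)) = b at h2 ⊢
  generalize Nat.card ↥((D.atLevel 𝓕 d).selmerGroup ⊓ (nsmulAddMonoidHom N).ker) = x at h1 ⊢
  generalize Nat.card ↥((D.atLevel 𝓕 (insert q d)).selmerGroup ⊓ (nsmulAddMonoidHom N).ker) = y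
    at h2 ⊢
  subst hB h1 h2
  ring

/-! ### §2 Case 1 of Mazur–Rubin's proof: counting inside `p^{m−k} H¹_{𝓕(d)}` -/

section CaseOne

variable {A : Type*} [AddCommGroup A]

/-- `p^t ∘ p^s = p^{t+s}` on subgroups: `p^t (p^s G) = p^{t+s} G`. [folklore] -/
theorem map_nsmul_map_nsmul (G : AddSubgroup A) (s t : ℕ) :
    (G.map (nsmulAddMonoidHom s)).map (nsmulAddMonoidHom t) = G.map (nsmulAddMonoidHom (t * s)) := by
  rw [AddSubgroup.map_map]
  congr 1
  ext x
  simp only [AddMonoidHom.coe_comp, Function.comp_apply, nsmulAddMonoidHom_apply, mul_nsmul']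

/-- **Case 1, counted.**  In a subgroup `G` killed by `p^{a+j+r}` whose multiples have the orders
`#p^a G = p^{j+r}`, `#p^{a+r} G = p^j`, `#p^{a+j} G = p^r` (the core-rank-one counts of
`H¹_{𝓕(d)}(K, T)`, `T` of length `a + j + r`, `λ(d, T^*) = j`): an element of `p^a G` killed by
`p^r` lies in `p^{a+j} G` — "`κ_n` belongs to this image, and is killed by `𝔪^{k−j}`, we conclude
that `κ_n ∈ 𝔪^j H(n)`" (Mazur–Rubin p. 47, with `p^a G` for the image of `H¹_{𝓕̃(n)}(ℚ, T̃)`).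
[cite: MazurRubin2004, Thm. 4.4.3, proof, Case 1 (p. 47)] -/
theorem mem_map_nsmul_add_of_counts {p : ℕ} [hp : Fact p.Prime] (G : AddSubgroup A) [Finite G]
    {a j r : ℕ} (hG : ∀ x ∈ G, p ^ (a + j + r) • x = 0)
    (h1 : Nat.card ↥(G.map (nsmulAddMonoidHom (p ^ a))) = p ^ (j + r))
    (h2 : Nat.card ↥(G.map (nsmulAddMonoidHom (p ^ (a + r)))) = p ^ j)
    (h3 : Nat.card ↥(G.map (nsmulAddMonoidHom (p ^ (a + j)))) = p ^ r)
    {x : A} (hx : x ∈ G.map (nsmulAddMonoidHom (p ^ a))) (hxr : p ^ r • x = 0) :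
    x ∈ G.map (nsmulAddMonoidHom (p ^ (a + j))) := by
  haveI : Finite ↥(G.map (nsmulAddMonoidHom (p ^ a))) := finite_map _ _
  haveI : Finite ↥(G.map (nsmulAddMonoidHom (p ^ a)) ⊓ (nsmulAddMonoidHom (p ^ r)).ker) :=
    finite_inf_left _ _
  -- `#(p^a G ∩ ker p^r) · #(p^{a+r} G) = #(p^a G)`
  have hc := card_eq_card_inf_ker_mul_card_map (nsmulAddMonoidHom (p ^ r))
    (G.map (nsmulAddMonoidHom (p ^ a)))
  rw [map_nsmul_map_nsmul, ← pow_add, add_comm r a, h1, h2] at hc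
  -- so `#(p^a G ∩ ker p^r) = p^r`
  have hcard : Nat.card ↥(G.map (nsmulAddMonoidHom (p ^ a)) ⊓ (nsmulAddMonoidHom (p ^ r)).ker) =
      p ^ r := by
    have hpj : 0 < p ^ j := pow_pos hp.out.pos _
    have : p ^ j * p ^ r = p ^ j *
        Nat.card ↥(G.map (nsmulAddMonoidHom (p ^ a)) ⊓ (nsmulAddMonoidHom (p ^ r)).ker) := by
      rw [← pow_add, hc, mul_comm]
    exact (Nat.eq_of_mul_eq_mul_left hpj this).symm
  -- `p^{a+j} G ≤ p^a G ∩ ker p^r`, with the same order: equality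
  have hle : G.map (nsmulAddMonoidHom (p ^ (a + j))) ≤
      G.map (nsmulAddMonoidHom (p ^ a)) ⊓ (nsmulAddMonoidHom (p ^ r)).ker := by
    rintro y hy
    obtain ⟨g, hg, rfl⟩ := AddSubgroup.mem_map.mp hy
    refine AddSubgroup.mem_inf.2 ⟨?_, ?_⟩
    · refine AddSubgroup.mem_map.2 ⟨p ^ j • g, G.nsmul_mem hg _, ?_⟩
      simp only [nsmulAddMonoidHom_apply, ← mul_nsmul', ← pow_add]
    · rw [AddMonoidHom.mem_ker, nsmulAddMonoidHom_apply, nsmulAddMonoidHom_apply, ← mul_nsmul',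
        ← pow_add, show r + (a + j) = a + j + r by ring]
      exact hG g hg
  have heq := AddSubgroup.eq_of_le_of_card_ge hle (by rw [hcard, h3])
  rw [heq]
  exact AddSubgroup.mem_inf.2 ⟨hx, by rw [AddMonoidHom.mem_ker, nsmulAddMonoidHom_apply]; exact hxr⟩

/-- The counts of the multiples from the counts of the torsion: if `G` is killed by `p^m` with
`#G[p^t] = p^t · p^j` and `#G = p^m · p^j` then `#p^t G = p^{m−t}`. [cite: MazurRubin2004, Thm. 4.1.13 and Lemma 4.1.1 (i)] -/
theorem card_map_nsmul_of_counts {p : ℕ} [hp : Fact p.Prime] (G : AddSubgroup A) [Finite G]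
    {m j t : ℕ} (htm : t ≤ m) (hGm : Nat.card G = p ^ m * p ^ j)
    (hGt : Nat.card ↥(G ⊓ (nsmulAddMonoidHom (p ^ t)).ker) = p ^ t * p ^ j) :
    Nat.card ↥(G.map (nsmulAddMonoidHom (p ^ t))) = p ^ (m - t) := by
  haveI : Finite ↥(G ⊓ (nsmulAddMonoidHom (p ^ t)).ker) := finite_inf_left _ _
  have hc := card_eq_card_inf_ker_mul_card_map (nsmulAddMonoidHom (p ^ t)) G
  rw [hGm, hGt] at hc
  have hpos : 0 < p ^ t * p ^ j := Nat.mul_pos (pow_pos hp.out.pos _) (pow_pos hp.out.pos _)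
  obtain ⟨c, rfl⟩ := Nat.exists_eq_add_of_le htm
  rw [Nat.add_sub_cancel_left]
  have : p ^ t * p ^ j * p ^ c = p ^ t * p ^ j *
      Nat.card ↥(G.map (nsmulAddMonoidHom (p ^ t))) := by
    rw [← hc]; ring
  exact (Nat.eq_of_mul_eq_mul_left hpos this).symm

/-- Stability of the torsion filtration: if `#Y[p^k] = p^j` with `j < k` (and `Y` is killed by some
`p^m`), then `Y[p^i] = Y[p^k]` for every `i ≥ j` — "`X[𝔪^k]` has length `j < k`, so `X[𝔪^k] = X`".
[cite: MazurRubin2004, Thm. 4.4.3, proof, Case 1 (p. 47)] -/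
theorem inf_ker_nsmul_eq_of_card_lt {p : ℕ} (Y : AddSubgroup A)
    {j k : ℕ} (hjk : j < k) [Finite ↥(Y ⊓ (nsmulAddMonoidHom (p ^ k)).ker)]
    (hcard : Nat.card ↥(Y ⊓ (nsmulAddMonoidHom (p ^ k)).ker) = p ^ j) (i : ℕ) (hi : j ≤ i) :
    Y ⊓ (nsmulAddMonoidHom (p ^ i)).ker = Y ⊓ (nsmulAddMonoidHom (p ^ k)).ker := by
  -- `Y[p^k]` is killed by `p^j`, hence `Y[p^k] ≤ Y[p^j]`
  have hkj : Y ⊓ (nsmulAddMonoidHom (p ^ k)).ker ≤ Y ⊓ (nsmulAddMonoidHom (p ^ j)).ker := by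
    intro y hy
    refine AddSubgroup.mem_inf.2 ⟨(AddSubgroup.mem_inf.1 hy).1, ?_⟩
    rw [AddMonoidHom.mem_ker, nsmulAddMonoidHom_apply, ← hcard]
    exact card_nsmul_eq_zero_of_mem _ hy
  -- monotonicity `Y[p^s] ≤ Y[p^t]` for `s ≤ t`
  have hmono : ∀ s t : ℕ, s ≤ t →
      Y ⊓ (nsmulAddMonoidHom (p ^ s)).ker ≤ Y ⊓ (nsmulAddMonoidHom (p ^ t)).ker := by
    intro s t hst y hy
    refine AddSubgroup.mem_inf.2 ⟨(AddSubgroup.mem_inf.1 hy).1, ?_⟩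
    have h := (AddSubgroup.mem_inf.1 hy).2
    rw [AddMonoidHom.mem_ker, nsmulAddMonoidHom_apply] at h ⊢
    obtain ⟨c, rfl⟩ := Nat.exists_eq_add_of_le hst
    rw [pow_add, mul_nsmul, h, nsmul_zero]
  -- for `i ≤ k`: squeezed between `Y[p^j]` and `Y[p^k]`
  by_cases hik : i ≤ k
  · exact le_antisymm (hmono i k hik) (hkj.trans (hmono j i hi))
  · -- for `i > k`: induction on `i`
    push Not at hik
    obtain ⟨c, rfl⟩ := Nat.exists_eq_add_of_lt hik
    clear hi hik
    induction c with
    | zero =>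
      refine le_antisymm ?_ (hmono _ _ (by omega))
      intro y hy
      have hy1 := (AddSubgroup.mem_inf.1 hy).1
      have hy2 := (AddSubgroup.mem_inf.1 hy).2
      rw [AddMonoidHom.mem_ker, nsmulAddMonoidHom_apply, Nat.add_zero, pow_succ', mul_nsmul] at hy2
      -- `p • y ∈ Y[p^k] ≤ Y[p^j]`, so `p^{j+1} y = 0`, so `y ∈ Y[p^{j+1}] ≤ Y[p^k]`
      have hpy : p • y ∈ Y ⊓ (nsmulAddMonoidHom (p ^ k)).ker :=
        AddSubgroup.mem_inf.2 ⟨Y.nsmul_mem hy1 _, by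
          rw [AddMonoidHom.mem_ker, nsmulAddMonoidHom_apply]; exact hy2⟩
      have hpy' := (AddSubgroup.mem_inf.1 (hkj hpy)).2
      rw [AddMonoidHom.mem_ker, nsmulAddMonoidHom_apply, ← mul_nsmul, ← pow_succ'] at hpy'
      exact hmono (j + 1) k hjk (AddSubgroup.mem_inf.2 ⟨hy1, by
        rw [AddMonoidHom.mem_ker, nsmulAddMonoidHom_apply]; exact hpy'⟩)
    | succ c IH =>
      refine le_antisymm ?_ (hmono _ _ (by omega))
      intro y hy
      have hy1 := (AddSubgroup.mem_inf.1 hy).1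
      have hy2 := (AddSubgroup.mem_inf.1 hy).2
      rw [AddMonoidHom.mem_ker, nsmulAddMonoidHom_apply,
        show k + (c + 1) + 1 = (k + c + 1) + 1 by ring, pow_succ', mul_nsmul] at hy2
      have hpy : p • y ∈ Y ⊓ (nsmulAddMonoidHom (p ^ (k + c + 1))).ker :=
        AddSubgroup.mem_inf.2 ⟨Y.nsmul_mem hy1 _, by
          rw [AddMonoidHom.mem_ker, nsmulAddMonoidHom_apply]; exact hy2⟩
      rw [IH] at hpy
      have hpy' := (AddSubgroup.mem_inf.1 (hkj hpy)).2
      rw [AddMonoidHom.mem_ker, nsmulAddMonoidHom_apply, ← mul_nsmul, ← pow_succ'] at hpy'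
      exact hmono (j + 1) k hjk (AddSubgroup.mem_inf.2 ⟨hy1, by
        rw [AddMonoidHom.mem_ker, nsmulAddMonoidHom_apply]; exact hpy'⟩)

end CaseOne


end StubLift

end Summit.BirchSwinnertonDyer.BirchSwinnertonDyer.Theorems.KimAtThreeDeepUpperStubCounting

end
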